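import Summits.HubbardSuperconductivity.HubbardSuperconductivity.Theorems.NodalWardXYDefs

/-!
# `PerturbedXYOrder` (stmt-HubbardSuperconductivity-10739) — line `schwarz-inheritance`, stub `stub_oddKernelExample`

The reflection-odd imaginary class contains admissible local kernels.  Let `R x = (-x₀, x₁, x₂)` be the
torus reflection (`Function.update x 0 (-x 0)`) and `K₀((x,0),(x',1)) = i (δ_{x',x} + δ_{x',x+e₀})`, zero on all
other pairs of bonds.  Then `W_{K₀}(θ ∘ R) = -W_{K₀}(θ)` (reindex the double bond sum by the involution
`(x,0) ↦ (R x − e₀, 0)`, `(x,i) ↦ (R x, i)` for `i ≠ 0`, under which the support of `K₀` is invariant, the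
direction-`0` current changes sign and the direction-`1` current does not), and `(εt)·K₀` is admissible at
radius `ε` for `|t| ≤ 1/16` (its entries sit at torus distance `≤ 1`, so `(1 + dist)⁴ ≤ 16`).

No definitions: the reflection is written `Function.update x 0 (-x 0)` throughout and the bond involution is
produced inside the proof of `oke_odd`.
-/

noncomputable section

namespace Summit.HubbardSuperconductivity.HubbardSuperconductivity.Theorems.PerturbedXYOrder

open MeasureTheory Literature.Probability.LatticeModels
open Summit.HubbardSuperconductivity.HubbardSuperconductivity.Theses.NodalWardXY

variable {L : ℕ}

/-! ### The reflection `R x = (-x₀, x₁, x₂)` on sites -/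

/-- `R` is an involution: `R (R x) = x`. -/
theorem oke_R_R (x : TorusSite 3 L) :
    Function.update (Function.update x 0 (-x 0)) 0 (-(Function.update x 0 (-x 0)) 0) = x := by
  funext j
  by_cases hj : j = 0
  · subst hj
    simp
  · simp [hj]

/-- `R (x + e₀) = R x - e₀`. -/
theorem oke_R_add_e0 (x : TorusSite 3 L) :
    Function.update (x + Pi.single 0 1) 0 (-(x + Pi.single 0 1 : TorusSite 3 L) 0) =
      Function.update x 0 (-x 0) - Pi.single 0 1 := by
  funext j
  by_cases hj : j = 0
  · subst hj
    simp only [Function.update_self, Pi.add_apply, Pi.sub_apply, Pi.single_eq_same]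
    ring
  · simp [hj]

/-- `R (x - e₀) = R x + e₀`. -/
theorem oke_R_sub_e0 (x : TorusSite 3 L) :
    Function.update (x - Pi.single 0 1) 0 (-(x - Pi.single 0 1 : TorusSite 3 L) 0) =
      Function.update x 0 (-x 0) + Pi.single 0 1 := by
  funext j
  by_cases hj : j = 0
  · subst hj
    simp only [Function.update_self, Pi.add_apply, Pi.sub_apply, Pi.single_eq_same]
    ring
  · simp [hj]

/-- `R (x + e₁) = R x + e₁`. -/
theorem oke_R_add_e1 (x : TorusSite 3 L) :
    Function.update (x + Pi.single 1 1) 0 (-(x + Pi.single 1 1 : TorusSite 3 L) 0) =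
      Function.update x 0 (-x 0) + Pi.single 1 1 := by
  funext j
  by_cases hj : j = 0
  · subst hj
    simp only [Function.update_self, Pi.add_apply, Pi.single_eq_of_ne (by decide : (0 : Fin 3) ≠ 1)]
    ring
  · simp [hj]

/-! ### Transformation of the currents under `θ ↦ θ ∘ R` -/

/-- The direction-`0` current is odd: `j_{(x,0)}(θ ∘ R) = -j_{(R x - e₀, 0)}(θ)`. -/
theorem oke_cur_zero (x : TorusSite 3 L) (θ : TorusSite 3 L → ℝ) :
    cur ((x, 0) : Bond L) (fun y => θ (Function.update y 0 (-y 0))) =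
      -cur ((Function.update x 0 (-x 0) - Pi.single 0 1, 0) : Bond L) θ := by
  simp only [cur]
  rw [oke_R_add_e0, sub_add_cancel, ← Real.sin_neg, neg_sub]

/-- The direction-`1` current is even: `j_{(x,1)}(θ ∘ R) = j_{(R x, 1)}(θ)`. -/
theorem oke_cur_one (x : TorusSite 3 L) (θ : TorusSite 3 L → ℝ) :
    cur ((x, 1) : Bond L) (fun y => θ (Function.update y 0 (-y 0))) =
      cur ((Function.update x 0 (-x 0), 1) : Bond L) θ := by
  simp only [cur]
  rw [oke_R_add_e1]

/-! ### Oddness of `W_K` from a bond involution -/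

/-- **Oddness from a bond involution.** If `Φ` is an involution of the bonds preserving the kernel `K`, and on
the support of `K` the current products transform as `j_b(θ') j_{b'}(θ') = -j_{Φ b}(θ) j_{Φ b'}(θ)`, then
`W_K(θ') = -W_K(θ)` (reindex the double sum by `Φ × Φ`). -/
theorem oke_Wk_eq_neg_of_involutive [NeZero L] (K : Bond L → Bond L → ℂ) (θ θ' : TorusSite 3 L → ℝ)
    (Φ : Bond L → Bond L) (hΦ : Function.Involutive Φ) (hK : ∀ b b', K (Φ b) (Φ b') = K b b')
    (hcur : ∀ b b', K b b' ≠ 0 →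
      (cur b θ' : ℂ) * (cur b' θ' : ℂ) = -((cur (Φ b) θ : ℂ) * (cur (Φ b') θ : ℂ))) :
    Wk K θ' = -Wk K θ := by
  have hterm : ∀ b b', K b b' * (cur b θ' : ℂ) * (cur b' θ' : ℂ) =
      -(K (Φ b) (Φ b') * (cur (Φ b) θ : ℂ) * (cur (Φ b') θ : ℂ)) := by
    intro b b'
    rw [hK]
    by_cases h : K b b' = 0
    · rw [h]
      ring
    · rw [mul_assoc, hcur b b' h]
      ring
  unfold Wk
  simp_rw [hterm, Finset.sum_neg_distrib]
  rw [neg_inj]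
  refine Fintype.sum_equiv (Function.Involutive.toPerm Φ hΦ) _ _ (fun b => ?_)
  exact Fintype.sum_equiv (Function.Involutive.toPerm Φ hΦ) _ _ (fun b' => rfl)

/-- **Oddness.** `W_{K₀}(θ ∘ R) = -W_{K₀}(θ)` for the mixed-direction kernel
`K₀((x,0),(x',1)) = i (δ_{x',x} + δ_{x',x+e₀})`: apply `oke_Wk_eq_neg_of_involutive` to the bond involution
`(x,0) ↦ (R x - e₀, 0)`, `(x,i) ↦ (R x, i)` (`i ≠ 0`). -/
theorem oke_odd [NeZero L] (θ : TorusSite 3 L → ℝ) :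
    Wk (fun b b' : Bond L =>
        if b.2 = 0 ∧ b'.2 = 1 ∧ (b'.1 = b.1 ∨ b'.1 = b.1 + Pi.single 0 1) then Complex.I else 0)
      (fun x => θ (Function.update x 0 (-x 0))) =
    -Wk (fun b b' : Bond L =>
        if b.2 = 0 ∧ b'.2 = 1 ∧ (b'.1 = b.1 ∨ b'.1 = b.1 + Pi.single 0 1) then Complex.I else 0) θ := by
  -- the bond involution, through its two defining equations
  obtain ⟨Φ, hΦ0, hΦne⟩ : ∃ Φ : Bond L → Bond L,
      (∀ x : TorusSite 3 L, Φ (x, 0) = (Function.update x 0 (-x 0) - Pi.single 0 1, 0)) ∧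
      (∀ (x : TorusSite 3 L) (i : Fin 3), i ≠ 0 → Φ (x, i) = (Function.update x 0 (-x 0), i)) :=
    ⟨fun b => (if b.2 = 0 then Function.update b.1 0 (-b.1 0) - Pi.single 0 1
        else Function.update b.1 0 (-b.1 0), b.2),
      fun x => by simp, fun x i hi => by simp [hi]⟩
  have hΦΦ : Function.Involutive Φ := by
    rintro ⟨x, i⟩
    by_cases hi : i = 0
    · subst hi
      rw [hΦ0, hΦ0, oke_R_sub_e0, oke_R_R, add_sub_cancel_right]
    · rw [hΦne x i hi, hΦne _ i hi, oke_R_R]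
  -- the support of `K₀` is `Φ`-invariant
  have hcond : ∀ b b' : Bond L, (b.2 = 0 ∧ b'.2 = 1 ∧ (b'.1 = b.1 ∨ b'.1 = b.1 + Pi.single 0 1)) →
      ((Φ b).2 = 0 ∧ (Φ b').2 = 1 ∧ ((Φ b').1 = (Φ b).1 ∨ (Φ b').1 = (Φ b).1 + Pi.single 0 1)) := by
    rintro ⟨x, i⟩ ⟨x', i'⟩ ⟨hi, hi', hx⟩
    dsimp only at hi hi' hx
    subst hi hi'
    rw [hΦ0, hΦne x' 1 (by decide)]
    dsimp only
    refine ⟨rfl, rfl, ?_⟩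
    rcases hx with rfl | rfl
    · exact Or.inr (sub_add_cancel _ _).symm
    · exact Or.inl (oke_R_add_e0 _)
  refine oke_Wk_eq_neg_of_involutive _ θ _ Φ hΦΦ (fun b b' => ?_) ?_
  · -- `K₀ (Φ b) (Φ b') = K₀ b b'`
    by_cases h : b.2 = 0 ∧ b'.2 = 1 ∧ (b'.1 = b.1 ∨ b'.1 = b.1 + Pi.single 0 1)
    · rw [if_pos h, if_pos (hcond b b' h)]
    · have h' : ¬ ((Φ b).2 = 0 ∧ (Φ b').2 = 1 ∧
          ((Φ b').1 = (Φ b).1 ∨ (Φ b').1 = (Φ b).1 + Pi.single 0 1)) := by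
        intro h'
        have h'' := hcond _ _ h'
        rw [hΦΦ b, hΦΦ b'] at h''
        exact h h''
      rw [if_neg h, if_neg h']
  · -- on the support the current product changes sign
    rintro ⟨x, i⟩ ⟨x', i'⟩ hne
    dsimp only at hne
    have h : i = 0 ∧ i' = 1 ∧ (x' = x ∨ x' = x + Pi.single 0 1) := by
      by_contra hc
      exact hne (if_neg hc)
    obtain ⟨rfl, rfl, -⟩ := h
    rw [hΦ0, hΦne x' 1 (by decide), oke_cur_zero x θ, oke_cur_one x' θ]
    push_cast
    ring

/-! ### Admissibility -/

/-- Entries of `K₀` sit at torus distance `≤ 1` (`x' = x`, or `x' = x + e₀` which is `x` itself when `L = 1` and a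
neighbour of `x` otherwise). -/
theorem oke_dist_le_one {b b' : Bond L}
    (h : b.2 = 0 ∧ b'.2 = 1 ∧ (b'.1 = b.1 ∨ b'.1 = b.1 + Pi.single 0 1)) :
    ((torusGraph 3 L).dist b.1 b'.1 : ℝ) ≤ 1 := by
  rcases h.2.2 with hx | hx
  · rw [hx, SimpleGraph.dist_self]
    simp
  · rw [hx]
    by_cases heq : b.1 = b.1 + Pi.single 0 1
    · rw [← heq, SimpleGraph.dist_self]
      simp
    · have hadj : (torusGraph 3 L).Adj b.1 (b.1 + Pi.single 0 1) :=
        (torusGraph_adj_iff _ _).2 ⟨heq, Or.inl ⟨0, rfl⟩⟩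
      rw [SimpleGraph.dist_eq_one_iff_adj.2 hadj]
      simp

/-- **Admissibility.** `(εt)·K₀` is admissible at radius `ε ≥ 0` for `|t| ≤ 1/16`: its nonzero entries have norm
`ε|t| ≤ ε/16 ≤ ε/(1 + dist)⁴`. -/
theorem oke_adm [NeZero L] (ε t : ℝ) (hε : 0 ≤ ε) (ht : |t| ≤ 1 / 16) :
    Admissible L ε (fun b b' : Bond L =>
      ((ε * t : ℝ) : ℂ) *
        (if b.2 = 0 ∧ b'.2 = 1 ∧ (b'.1 = b.1 ∨ b'.1 = b.1 + Pi.single 0 1) then Complex.I else 0)) := by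
  intro b b'
  have hden : (0 : ℝ) < (1 + ((torusGraph 3 L).dist b.1 b'.1 : ℝ)) ^ 4 := by positivity
  by_cases h : b.2 = 0 ∧ b'.2 = 1 ∧ (b'.1 = b.1 ∨ b'.1 = b.1 + Pi.single 0 1)
  · have hd1 := oke_dist_le_one h
    simp only [if_pos h]
    rw [norm_mul, Complex.norm_I, mul_one, Complex.norm_real, Real.norm_eq_abs, abs_mul,
      abs_of_nonneg hε, le_div_iff₀ hden]
    have h16 : (1 + ((torusGraph 3 L).dist b.1 b'.1 : ℝ)) ^ 4 ≤ 16 := by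
      have h2 : (1 + ((torusGraph 3 L).dist b.1 b'.1 : ℝ)) ≤ 2 := by linarith
      calc (1 + ((torusGraph 3 L).dist b.1 b'.1 : ℝ)) ^ 4 ≤ 2 ^ 4 :=
            pow_le_pow_left₀ (by positivity) h2 4
        _ = 16 := by norm_num
    calc ε * |t| * (1 + ((torusGraph 3 L).dist b.1 b'.1 : ℝ)) ^ 4 ≤ ε * (1 / 16) * 16 :=
          mul_le_mul (mul_le_mul_of_nonneg_left ht hε) h16 hden.le (mul_nonneg hε (by norm_num))
      _ = ε := by ring
  · simp only [if_neg h, mul_zero, norm_zero]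
    exact div_nonneg hε hden.le

/-- **Stub `stub_oddKernelExample` (c5 delineation): the reflection-odd class contains admissible local kernels.**
The mixed-direction kernel `K₀((x,0),(x',1)) = i (δ_{x',x} + δ_{x',x+e₀})` (zero on all other pairs), i.e.
`W_{K₀} = i Σ_x j_{(x,0)} (j_{(x,1)} + j_{(x+e₀,1)})`, is odd under `θ ↦ θ ∘ R`, `R x = (-x₀, x₁, x₂)`, and
`(εt)·K₀` is admissible at radius `ε` for `|t| ≤ 1/16`. -/
theorem stub_oddKernelExample (L : ℕ) [NeZero L] :
    (∀ θ : TorusSite 3 L → ℝ,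
        Wk (fun b b' : Bond L =>
            if b.2 = 0 ∧ b'.2 = 1 ∧ (b'.1 = b.1 ∨ b'.1 = b.1 + Pi.single 0 1) then Complex.I else 0)
          (fun x => θ (Function.update x 0 (-x 0))) =
        -Wk (fun b b' : Bond L =>
            if b.2 = 0 ∧ b'.2 = 1 ∧ (b'.1 = b.1 ∨ b'.1 = b.1 + Pi.single 0 1) then Complex.I else 0) θ) ∧
    (∀ ε t : ℝ, 0 ≤ ε → |t| ≤ 1 / 16 →
        Admissible L ε (fun b b' : Bond L =>
          ((ε * t : ℝ) : ℂ) *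
            (if b.2 = 0 ∧ b'.2 = 1 ∧ (b'.1 = b.1 ∨ b'.1 = b.1 + Pi.single 0 1) then Complex.I else 0))) :=
  ⟨oke_odd, oke_adm⟩

end Summit.HubbardSuperconductivity.HubbardSuperconductivity.Theorems.PerturbedXYOrder

end
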